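/- Copyright: the b2b-balaban cell (near-miss cell 7), T⁴-continuum fan-out; row NE7b CRUX team (2), seat
t4-ne7b-formalise-leaf-05 (gen 32) — the row OWNER's SPEC IR-46-2 «THE (α) ASSEMBLY» v0 l.15 «… leaf-05 toy», part 4 = the
L-twins under R-OWNER-48-1 «THE GUARDED CUT» (`CLAIMS.log` l.32451) via the custodian leaf-03 g27's `HistReadData.toL`
(W-ne7bleaf03-g27-1, l.32698).  Released under the licence of the surrounding project. -/
import Summits.QuantumFields.BalabanUV.T4Continuum.Support.HistoryRealiseCellsRunAssemblyWTVSSanityToyData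
import Summits.QuantumFields.BalabanUV.T4Continuum.Support.HistoryRealiseCellsRunAssemblyWTVSL

/-!
# Sanity for the (α) assembly, part 4: THE GUARDED RECORD `HistReadDataL` AND L5's END ON THE TOY — the toy reading boxes
its (absent) regions, so every FILE-1 toy record of parts 2∕3 IS an L4 record (`HistReadData.toL`), and L5's
`nonempty_countRoadWitnessT3bWTVSL_of_histReading` yields the GUARDED witness from part 2's displayed inputs for ANY datum
(`nonempty_countRoadWitnessT3bWTVSL_toy`), and on the cell's toy datum `HistReadDataL` ∕ the guarded witness with NO hypothesis
(`nonempty_histReadDataL_toyData`, `nonempty_countRoadWitnessT3bWTVSL_toyData_guarded`).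

Summits-side support leaf of the T⁴-continuum cell (rung (B)+1 on a FINITE torus only; NOT infinite volume, NOT the
mass gap, NOT Clay; NOT a proof of NE7b — NOT PRINTED, NOT PROVED).  [decided toy] one-liners over parts 1–3, the OWNER's
L4 `HistReadDataL` (p283718) and the custodian's L5 (`HistReadData.toL`, `nonempty_countRoadWitnessT3bWTVSL_of_histReadingL`);
nothing printed asserted, no `def … : Prop`, zero `sorry`.

HONEST.  As parts 2∕3: a node test of a hypothesis SHAPE; (B) FAILS on `toyData` (no headline instance); inhabiting the
guarded record on the no-region reading says nothing about readings with joins beyond what L4∕L5 type; NE7b NOT proved;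
spine 0∕9.  HONEST DEPENDENCY (cell): continuum YM on T⁴ ⇐ BetaPertH ∧ nine spine estimates (0/9 proved); BetaPertH ⇐
(D1) ∧ (D4) ∧ CAP+tail; G-an2-4 gates asym, D1 and NE2/3/4.  Unchanged here.
-/

open Finset MeasureTheory
open Literature.MathematicalPhysics.QuantumFieldTheory.Balaban1983to89
open Literature.MathematicalPhysics.QuantumFieldTheory.Balaban1983to89.B16SProfile (DropCtl)
open T4PersistenceDictionary T4PersistentHistoryCount T4BankedInduction T4PrintedShapeBanking
open T4WeightBudget T4GlobalDenominator T4LiveClassFibration T4LiveStructureGas T4LiveGasToTerms T4RecordPriceSeam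
open T4PartnerMultiplicity T4IndicatorShell T4MatchingAssembly T4MatchingClosure T4MatchingClosureSocket T4Continuum
open T4StabilitySocket T4BranchingRecordsGas T4TaggedShapeBanking T4CanonicalMenus T4RenewalChains
open Summit.QuantumFields.BalabanUV.T4Continuum.HistoryFlow Summit.QuantumFields.BalabanUV.T4Continuum.HistoryGen
open Summit.QuantumFields.BalabanUV.T4Continuum.HistoryAdmissible
open Summit.QuantumFields.BalabanUV.T4Continuum.HistoryGenealogyExtraction
open Summit.QuantumFields.BalabanUV.T4Continuum.HistoryGenealogyRealise
open Summit.QuantumFields.BalabanUV.T4Continuum.HistoryGenealogyInstantiate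
open Summit.QuantumFields.BalabanUV.T4Continuum.HistoryGenealogyPedigree
open Summit.QuantumFields.BalabanUV.T4Continuum.HistoryAssemblyPedigree Summit.QuantumFields.BalabanUV.T4Continuum.HistoryAssemblyTerms
open Summit.QuantumFields.BalabanUV.T4Continuum.HistoryAssemblyMult Summit.QuantumFields.BalabanUV.T4Continuum.HistoryAssemblyMultKey
open Summit.QuantumFields.BalabanUV.T4Continuum.HistoryAssemblyRealiseRun Summit.QuantumFields.BalabanUV.T4Continuum.HistorySocketTH
open Summit.QuantumFields.BalabanUV.T4Continuum.HistoryRealiseDistinct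
open Summit.QuantumFields.BalabanUV.T4Continuum.HistoryRealiseCellsRunApexT3bWTVS
open Summit.QuantumFields.BalabanUV.T4Continuum.B16HistoryIndexedRepr
open Summit.QuantumFields.BalabanUV.T4Continuum.B16HistoryIndexedTrunc
open Summit.QuantumFields.BalabanUV.T4Continuum.HistoryBankingLE Summit.QuantumFields.BalabanUV.T4Continuum.HistoryBankingVolumePlug
open Summit.QuantumFields.BalabanUV.T4Continuum.HistoryConstants Summit.QuantumFields.BalabanUV.T4Continuum.HistoryBankingDiscountCharge
open Summit.QuantumFields.BalabanUV.T4Continuum.HistoryBankingCreditRead Summit.QuantumFields.BalabanUV.T4Continuum.HistoryBankingFibreRoom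
open Summit.QuantumFields.BalabanUV.T4Continuum.HistoryPriceNodeSum Summit.QuantumFields.BalabanUV.T4Continuum.HistoryPriceKeys
open Summit.QuantumFields.BalabanUV.T4Continuum.HistoryRealiseCellsRunSupplyWTVS
open Summit.QuantumFields.BalabanUV.T4Continuum.HistoryRealiseCellsRunSupplyKeysWTVS
open Summit.QuantumFields.BalabanUV.T4Continuum.HistoryRealiseCellsRunSupplyWTVSSanity
open Summit.QuantumFields.BalabanUV.T4Continuum.HistoryRealiseCellsRunSupplyKeysWTVSSanity
open Summit.QuantumFields.BalabanUV.T4Continuum.HistoryRealiseCellsRunAssemblyWTVSData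
open Summit.QuantumFields.BalabanUV.T4Continuum.HistoryRealiseCellsRunAssemblyWTVS
open Literature.MathematicalPhysics.QuantumFieldTheory.Balaban1983to89.T4FiniteEpsInhabited
open Missing AveragingRT T4Continuum T4StabilitySocket T4MatchingClosure T4IndicatorShell T4LiveClassFibration
open T4RenewalChains T4PersistenceDictionary T4BranchingRecordsGas T4PrintedShapeBanking T4TaggedShapeBanking
open Summit.QuantumFields.BalabanUV.T4Continuum.HistoryRealiseCellsRunApexWitness
open Summit.QuantumFields.BalabanUV.T4Continuum.HistoryRealiseCellsRunApexT3bWTVSL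
open Summit.QuantumFields.BalabanUV.T4Continuum.HistoryRealiseCellsRunAssemblyWTVSDataL
open Summit.QuantumFields.BalabanUV.T4Continuum.HistoryRealiseCellsRunAssemblyWTVSL

namespace Summit.QuantumFields.BalabanUV.T4Continuum.HistoryRealiseCellsRunAssemblyWTVSSanity

noncomputable section

open B16HistoryIndexedRepr.Sanity B16HistoryIndexedRepr.SanityInput HistoryConstants.Sanity

set_option synthInstance.maxSize 1024

section L

/-- **L5's END ON THE TOY RECORD OF PART 2, FOR ANY DATUM** (the custodian's `nonempty_countRoadWitnessT3bWTVSL_of_histReading`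
= L5 §1 ∘ `HistReadData.toL`, the input display `hreg := regionsInBox_run₃` vacuous): from measurable averagings, the K-uniform
envelope `hZ`, (2.5) `isRj`, the (γ) floors ∕ site budgets and the NE7 budget socket ALONE, the GUARDED witness. [folklore] -/
theorem nonempty_countRoadWitnessT3bWTVSL_toy {F : T4Family} {G : Type*} [GaugeGroup G] [MeasurableSpace G] [HaarData G]
    [RegularGaugeGroup G] (D : FiniteEpsData F G) (hM : D.AvgMeasurable) (θv : ℝ) (rr n : ℕ) (hn : 0 < n) (g₀ : ℕ → ℝ)
    (os : List (ULoop F)) {Zi : ℝ} (hZ : ∀ K t, |t| ≤ 1 → ZD D g₀ os K t ≤ Zi)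
    (isRj : ∀ K s, s ≤ K → B14.IsRj F.L rr ((D.C ⟨K, F.m, g₀ K⟩).flow.g s) F.L)
    {c₀ n₁ : ℝ} (c₀_pos : 0 < c₀) (floor : ∀ K, c₀ ≤ smallFieldMass D K (g₀ K))
    (floor' : ∀ K, c₀ ≤ smallFieldMass D (K + 1) (g₀ (K + 1)))
    (sites : ∀ K, ((D.C ⟨K, F.m, g₀ K⟩).numSites K : ℝ) ≤ n₁)
    (sites' : ∀ K, ((D.C ⟨K + 1, F.m, g₀ (K + 1)⟩).numSites (K + 1) : ℝ) ≤ n₁)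
    {Cc Rr CcRec RrRec : ℕ → ℝ → HIndex.Idx Isk → ℝ} {ν u s₂ q₀ r s : ℕ → ℝ}
    (budget : ReindexedBudget 1 1 (HIndex.termSet Isk)
      (fun K t τ => Repr172R.weight μ₀ (fun K t => toyR (ZD D g₀ os K t)) t τ - (fun _ _ _ => (0 : ℝ)) K t τ)
      (fun K t τ => weightB μ₀ (fun K t => toyR (ZD D g₀ os K t)) trunc₃ K t τ - (fun _ _ _ => (0 : ℝ)) K t τ)
      (badOfClass (bstrOf Prod.fst (memA n F.L (ℛ₃ F.L))) (HIndex.termSet Isk)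
        (fun K _ => badClasses Prod.fst (memA n F.L (ℛ₃ F.L)) jhalf (HIndex.termSet Isk) K))
      Cc Rr CcRec RrRec ν u s₂ q₀ r s)
    (sum_r : Summable r) (sum_u : Summable u) (sum_s : Summable s) (sum_s₂ : Summable s₂) :
    Nonempty (CountRoadWitnessT3bWTVSL D C₂ O₁ θv rr 1 n hn g₀ os (HIndex.Idx Isk) (ℕ × Lab 1) (Lab 1)) :=
  nonempty_countRoadWitnessT3bWTVSL_of_histReading
    (histReadData₃ D hM θv rr n hn g₀ os hZ isRj c₀_pos floor floor' sites sites' (shell_toyR _) budget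
      sum_r sum_u sum_s sum_s₂) fun K _ τ _ => regionsInBox_run₃ F.L n K τ

variable (F : T4Family) (G : Type) [GaugeGroup G] [MeasurableSpace G] [HaarData G] [RegularGaugeGroup G]

/-- **THE GUARDED RECORD `HistReadDataL` IS INHABITED — NO HYPOTHESIS** — on the toy datum × the no-region toy reading:
part 3's FILE-1 record carried along the custodian's `HistReadData.toL` with the input display `hreg := regionsInBox_run₃`
(vacuous: no new region). [decided toy] -/
theorem nonempty_histReadDataL_toyData (θv : ℝ) (n : ℕ) (hn : 0 < n) :
    Nonempty (HistReadDataL (toyData F G) C₂ O₁ θv 1 1 n hn gE ([] : List (ULoop F)) Isk Isk (fun _ => Unit) μ₀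
      (fun _ => GoodClass.top Unit) (fun _ => Unit) μ₀ (fun _ => GoodClass.top Unit)) :=
  ⟨(histReadData₃ (toyData F G) (avgMeasurable_toyData F G) θv 1 n hn gE ([] : List (ULoop F)) (ZD_toyData_le F G gE)
    (fun K s _ => isRj_toyData F G K s) (c₀ := 1) (n₁ := 0) one_pos (fun K => (smallFieldMass_toy F G K _).symm.le)
    (fun K => (smallFieldMass_toy F G (K + 1) _).symm.le) (fun K => by simp) (fun K => by simp) (shell_toyR _)
    (budget_toyR (fun K t _ => ZD_pos (toyData F G) (avgMeasurable_toyData F G) gE _ K t) _ (ZD_toyData_succ F G gE) _)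
    summable_zero summable_zero summable_zero summable_zero).toL fun K _ τ _ => regionsInBox_run₃ F.L n K τ⟩

/-- **L5's END ON IT: THE GUARDED WITNESS `CountRoadWitnessT3bWTVSL` ON THE TOY DATUM THROUGH THE GUARDED ASSEMBLY ROAD —
no hypothesis** (`nonempty_countRoadWitnessT3bWTVSL_of_histReadingL`). [decided toy] -/
theorem nonempty_countRoadWitnessT3bWTVSL_toyData_guarded (θv : ℝ) (n : ℕ) (hn : 0 < n) :
    Nonempty (CountRoadWitnessT3bWTVSL (toyData F G) C₂ O₁ θv 1 1 n hn gE ([] : List (ULoop F)) (HIndex.Idx Isk)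
      (ℕ × Lab 1) (Lab 1)) :=
  (nonempty_histReadDataL_toyData F G θv n hn).elim fun Dd => nonempty_countRoadWitnessT3bWTVSL_of_histReadingL Dd

end L

end

end Summit.QuantumFields.BalabanUV.T4Continuum.HistoryRealiseCellsRunAssemblyWTVSSanity
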